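import Literature.NumberTheory.Automorphic.KimExteriorSquareGL4
import HarnessLib

/-!
# Asgari–Raghuram: the cuspidality criterion for Kim's exterior square lift `∧² : GL₄ → GL₆`
# (direction "not cuspidal ⇒ essentially self-dual or self-twisted", Satake form; named fact)

Topic `NumberTheory/Automorphic`; namespace `Literature.NumberTheory.Automorphic`.

Source: M. Asgari, A. Raghuram, *A cuspidality criterion for the exterior square transfer of cusp
forms on GL(4)*, in: On Certain L-Functions (Clay Math. Proc. 13, 2011) 33–53 = arXiv:0712.4315
[AsgariRaghuram2007]; quotations from the held arXiv text (`paper:arxiv-0712.4315`, p. 3 of the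
materialised text = §1).

> **Theorem 1.** "Let `F` be a number field and let `Π` be a cuspidal automorphic representation
> of `GL(4, 𝔸_F)`. The following are equivalent:
> (i) `∧²Π` is not cuspidal.
> (ii) `Π` is one of the following: (a) `Π = π₁ ⊠ π₂` …; (b) `Π = As(π)`, the Asai transfer of a
> dihedral cuspidal automorphic representation `π` of `GL(2, 𝔸_E)` …; (c) `Π` is the functorial
> transfer of a cuspidal representation `π` of `GSp(4, 𝔸_F)` …; (d) `Π = I_E^F(π)`, the
> automorphic induction of a cuspidal automorphic representation `π` of `GL(2, 𝔸_E)`, where `E/F`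
> is a quadratic extension.
> (iii) `Π` satisfies one of the following: (α) `Π ≅ Π̃ ⊗ χ` for some Hecke character `χ` of `F`,
> and `Π` is not the Asai transfer of a nondihedral cuspidal representation. (β) `Π ≅ Π ⊗ χ` for a
> nontrivial Hecke character `χ` of `F`."

Here (p. 3) "`Σ` is an exterior square transfer of `Π` if for all `v ∉ S` we have
`Σ_v = ∧²(Π_v)` …; by strong multiplicity one theorem … such a `Σ` would be unique. We will denote
it by `∧²Π`. The existence of `∧²Π` was established by H. Kim" (the tree's named fact
`Kim2003_exteriorSquare_GL4`, `KimExteriorSquareGL4.lean`, with `wedgeTwoParams α = {αᵢαⱼ : i < j}`).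

## What is vendored and why it is implied by the printed theorem

Only the direction **(i) ⇒ (iii)** (the "more difficult" converse, §4 of the paper: Langlands–Shahidi
method on `GSpin(2m+6)` plus Kim's theorem; no descent is used in this direction), in the
Satake-level language of the tree (no local components, no isobaric sums, no Asai transfer are
available as carriers — exactly the rendering conventions of `Kim2003_exteriorSquare_GL4` and of
`isIrreducible_galoisRep_gl4_totallyReal_of_not_essSelfDual`):

* hypothesis "`∧²Π` is not cuspidal" is rendered as: there is NO cuspidal datum `Σ` on `GL₆(𝔸_F)`
  whose Satake parameter is `wedgeTwoParams α` at almost every finite `v` where `Π` has parameter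
  `α`. This is implied by (in fact equivalent to) the printed hypothesis: were `∧²Π` (Kim's isobaric
  transfer) cuspidal it would be such a `Σ`; conversely such a cuspidal `Σ` agrees with the isobaric
  `∧²Π` at almost all places, hence equals it by Jacquet–Shalika (Theorem 2 of the paper). So the
  rendered hypothesis is STRONGER-or-equal than the printed one — safe.
* conclusion (α) is rendered WITHOUT its exceptional conjunct (weaker than print): there is a
  `GL(1)` datum `η` with `t_{Π,v}⁻¹ = η(ϖ_v)·t_{Π,v}` (as multisets) for almost all `v` — from
  `Π ≅ Π̃ ⊗ χ` take `η :=` the datum of `χ⁻¹` (`t_{Π̃,v} = t_{Π,v}⁻¹`, `t_{Π⊗χ,v} = χ(ϖ_v)t_{Π,v}`;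
  the `GL(1)` dictionary of the tree, `GLOneOfHeckeCharacterBJ` /
  `AutomorphicRepData.exists_heckeCharacter_glOne`, and
  `AutomorphicRepData.eventually_hasSatakeParamAt_glOne`: Satake parameters of a `GL(1)` datum are
  the values at uniformizers).
* conclusion (β) is rendered as: there is a `GL(1)` datum `ξ` with `t_{Π,v} = ξ(ϖ_v)·t_{Π,v}` for
  almost all `v` and `ξ` NOT unramified-trivial at almost all `v` (`¬ ∀ᶠ v, ξ` has parameter `{1}`).
  Printed "nontrivial" implies this: a Hecke character with `χ_v(ϖ_v) = 1`, `χ_v` unramified, for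
  almost all `v` is trivial (weak approximation; the tree's `StrongMultiplicityOneGLOne`).

Kim's and Asgari–Raghuram's standing convention "cuspidal = unitary cuspidal" is a normalisation
without effect on the statement: `Π = Π⁰ ⊗ |det|^s`, `∧²Π = ∧²Π⁰ ⊗ |det|^{2s}`, and cuspidality of
the `GL₆` side, essential self-duality and self-twists are all stable under such twists (as in the
module docstring of `KimExteriorSquareGL4`). Level witnesses `h1 h4 h6` are threaded as in the
Langlands route items. Consumed by route `Langlands/ExteriorSquareAscent`, crux
`Summit.Langlands.Langlands.Theses.ExteriorSquareAscent.InducedSquareAscent` (applied over the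
quadratic field `L` to `BC_L π`).

## References

* M. Asgari, A. Raghuram, arXiv:0712.4315 = Clay Math. Proc. 13 (2011) 33–53, Theorem 1.1 (§1)
  and §4 (Props. 4.1–4.2 of the arXiv text = "Props 11–12"). [AsgariRaghuram2007]
* H. H. Kim, J. Amer. Math. Soc. 16 (2003) 139–183, Theorem A. [Kim2002]
* H. Jacquet, J. Shalika, Amer. J. Math. 103 (1981), Thm. 4.4 (isobaric strong multiplicity one).
-/

noncomputable section

open scoped Classical MatrixGroups
open IsDedekindDomain NumberField

namespace Literature.NumberTheory.Automorphic

/-- **Asgari–Raghuram 2007, Theorem 1, direction (i) ⇒ (iii) (Satake form).** *Let `F` be a number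
field and `Π` a cuspidal automorphic representation of `GL(4, 𝔸_F)`. If `∧²Π` is not cuspidal, then
(α) `Π ≅ Π̃ ⊗ χ` for some Hecke character `χ` of `F` […], or (β) `Π ≅ Π ⊗ χ` for a nontrivial Hecke
character `χ` of `F`.*  Rendered (module docstring): if NO cuspidal datum `Σ` on `GL₆(𝔸_F)` has
Satake parameter `wedgeTwoParams α = {αᵢαⱼ : i < j}` at almost every finite place `v` where `Π` has
Satake parameter `α`, then EITHER there is a `GL(1)` datum `η` with `t_{Π,v}⁻¹ = η(ϖ_v) · t_{Π,v}`
(as multisets) for almost all `v` (Π essentially self-dual at Satake level), OR there is a `GL(1)`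
datum `ξ`, not unramified-trivial at almost all places, with `t_{Π,v} = ξ(ϖ_v) · t_{Π,v}` for almost
all `v` (a nontrivial self-twist at Satake level). Hypothesis stronger-or-equal, conclusion
weaker-or-equal than print (the exceptional clause of (α) is dropped), so the fact is implied by the
printed theorem together with Kim's existence theorem and Jacquet–Shalika. Grounds
`Summit.Langlands.Langlands.Theses.ExteriorSquareAscent.InducedSquareAscent` (its "AR Thm 1
(i)⇒(iii) over L" step). [cite: AsgariRaghuram2007, Theorem 1.1 (i)⇒(iii), §1 and §4] -/
def AsgariRaghuram2007_notCuspidal_wedgeTwo_imp : Prop :=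
  ∀ (F : Type) [Field F] [NumberField F] (h1 : isCompact_glFiniteIntegralLevel 1 F)
    (h4 : isCompact_glFiniteIntegralLevel 4 F) (h6 : isCompact_glFiniteIntegralLevel 6 F)
    (π : CuspidalAutomorphicRepData 4 F h4),
    (¬ ∃ P : CuspidalAutomorphicRepData 6 F h6,
        ∀ᶠ v : HeightOneSpectrum (𝓞 F) in Filter.cofinite, ∀ α : Multiset ℂ,
          π.1.HasSatakeParamAt v α → P.1.HasSatakeParamAt v (wedgeTwoParams α)) →
    (∃ η : CuspidalAutomorphicRepData 1 F h1,
        ∀ᶠ v : HeightOneSpectrum (𝓞 F) in Filter.cofinite, ∀ α : Multiset ℂ,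
          π.1.HasSatakeParamAt v α →
            ∃ e : ℂ, η.1.HasSatakeParamAt v {e} ∧ α.map (fun a => a⁻¹) = α.map (fun a => e * a)) ∨
    (∃ ξ : CuspidalAutomorphicRepData 1 F h1,
        (¬ ∀ᶠ v : HeightOneSpectrum (𝓞 F) in Filter.cofinite, ξ.1.HasSatakeParamAt v {1}) ∧
        ∀ᶠ v : HeightOneSpectrum (𝓞 F) in Filter.cofinite, ∀ α : Multiset ℂ,
          π.1.HasSatakeParamAt v α →
            ∃ e : ℂ, ξ.1.HasSatakeParamAt v {e} ∧ α.map (fun a => e * a) = α)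

/-- **Projection (contrapositive use): a cuspidal `Π` on `GL₄` that is neither essentially self-dual
nor self-twisted at Satake level has a CUSPIDAL exterior square** — the form in which route
`ExteriorSquareAscent` consumes the criterion ("`∧²π` cuspidal (AR, since `π` is neither ess.
self-dual nor self-twisted)"). [cite: AsgariRaghuram2007, Theorem 1.1] -/
theorem AsgariRaghuram2007_notCuspidal_wedgeTwo_imp.exists_cuspidal_wedgeTwo
    (h : AsgariRaghuram2007_notCuspidal_wedgeTwo_imp)
    (F : Type) [Field F] [NumberField F] (h1 : isCompact_glFiniteIntegralLevel 1 F)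
    (h4 : isCompact_glFiniteIntegralLevel 4 F) (h6 : isCompact_glFiniteIntegralLevel 6 F)
    (π : CuspidalAutomorphicRepData 4 F h4)
    (hα : ¬ ∃ η : CuspidalAutomorphicRepData 1 F h1,
        ∀ᶠ v : HeightOneSpectrum (𝓞 F) in Filter.cofinite, ∀ α : Multiset ℂ,
          π.1.HasSatakeParamAt v α →
            ∃ e : ℂ, η.1.HasSatakeParamAt v {e} ∧ α.map (fun a => a⁻¹) = α.map (fun a => e * a))
    (hβ : ¬ ∃ ξ : CuspidalAutomorphicRepData 1 F h1,
        (¬ ∀ᶠ v : HeightOneSpectrum (𝓞 F) in Filter.cofinite, ξ.1.HasSatakeParamAt v {1}) ∧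
        ∀ᶠ v : HeightOneSpectrum (𝓞 F) in Filter.cofinite, ∀ α : Multiset ℂ,
          π.1.HasSatakeParamAt v α →
            ∃ e : ℂ, ξ.1.HasSatakeParamAt v {e} ∧ α.map (fun a => e * a) = α) :
    ∃ P : CuspidalAutomorphicRepData 6 F h6,
      ∀ᶠ v : HeightOneSpectrum (𝓞 F) in Filter.cofinite, ∀ α : Multiset ℂ,
        π.1.HasSatakeParamAt v α → P.1.HasSatakeParamAt v (wedgeTwoParams α) := by
  by_contra hP
  rcases h F h1 h4 h6 π hP with hsd | hst
  · exact hα hsd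
  · exact hβ hst

end Literature.NumberTheory.Automorphic

end
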